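import Summits.ValiantsHypothesis.ValiantsHypothesis.Theorems.LacunarySymmetroidMatrixDescartesDoorA26WallBubblingRelativeDSieve
import Summits.ValiantsHypothesis.ValiantsHypothesis.Theorems.LacunarySymmetroidMatrixDescartesDoorA26WallBubblingWallExitMoments

/-!
# Wall bubbling for `DoorA26` — WALL EXIT WIRING (member currency): from class-sum domination to vanishing confluent moments of the merged class

LINE / STUBS.  Crux `Theses.LacunarySymmetroid.DoorA26` (stmt-ValiantsHypothesis-19979; OPEN, typed, never asserted), line
`Cruxes/DoorA26/Lines/wall_bubbling.lean` (val-idea-15); serves `Stmt.weylFaces_wall` (one Weyl pair), EXIT side.  W1 #13 (`relative_dSieve`,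
`realisable_classGram`) and #14 (`moment_div_tendsto_zero_of_member_bound`, `moment_two_div_tendsto_zero_of_weylMerged`) are stated in different
currencies (6 × 6 stage matrices / abstract member families).  This file WIRES them in the currency the (W) chain's assembly will hand over — stage
Gram VECTORS `a ν : Fin 6 × Fin 6 → ℝ` (realisable as matrices, as in `ClusterLimit` / `…SignedClusterData`), member deviations
`ε ν : Fin 6 × Fin 6 → ℝ` with `|ε| ≤ w → 0`, and a scale `μ ν > 0` DOMINATING THE CLASS SUMS that occur (the definition of the cluster scale in
`levelSelection_multi`) — so that the assembly only has to point at the classes (def-free):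

* `wallWiring_caseA` — ONE Weyl pair, relation `e_k + e_l = e_m + e_n` among the four NON-Weyl letters: if `μ` dominates the singleton classes
  `(x,x)` (`x ∈ {k,l,m,n}`), the four non-merged cross classes and the merged class sum `a(k,l)+a(l,k)+a(m,n)+a(n,m)`, then for every `r ≥ 1` the
  normalised `r`-th moment of the merged class `{(k,l),(l,k),(m,n),(n,m)}` tends to `0`;
* `wallWiring_caseB` — relation `e₀ + e_k = e_l + e_m` THROUGH the Weyl value of the pair `{i,j}`: if `μ` dominates the triple class sum
  `a(i,i)+a(i,j)+a(j,i)+a(j,j)`, the doubleton sums `a(i,x)+a(j,x)` (`x = l, m`), the singletons among `k,l,m`, the merged class sum and its FIRST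
  moment, then the normalised SECOND moment of the merged class `{(i,k),(k,i),(j,k),(k,j),(l,m),(m,l)}` tends to `0`.

So in both one-pair wall cases the merged class contributes to the limit object exactly the slots it has in the confluent determinant ON the wall
(`…ConfluentCount`, `…WallDoorStep`): door-free exit, modulo the shared middle.  TWO Weyl pairs: NAMED OPEN (`…WallExitMoments` header).
SPLIT CHAINS (line lead 2026-08-28T19:28Z (r3), W2 paper flag R2757): this wiring, like #13–#15, is PER CLUSTER — it controls the limit object of ONE
blow-up cluster; chains with two or more clusters at diverging log-distances have one limit object per cluster and inherit the generic face's OPEN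
«(W-split) multi-scale linking» gap (the confluent extra slot cashed in a partial cluster) — part of the shared middle, not closed here.
Nothing in this file bears on (W)/(M)/(R) themselves, on `DoorA26`, on `MatrixDescartes` (stmt-ValiantsHypothesis-18050) or on `VP ≠ VNP`.

Seat val-sym-door-p2 g12 (W1 #18), `--supports stmt-ValiantsHypothesis-19979 --as helper`. [this work] bookkeeping over #13/#14.
-/

-- `Summit.ValiantsHypothesis.ValiantsHypothesis.…` repeats a component by the D-0017 layout
-- (single-conjunct summit), which the `dupNamespace` linter flags; the name is mandated.
set_option linter.dupNamespace false

namespace Summit.ValiantsHypothesis.ValiantsHypothesis.Theorems.LacunarySymmetroidMatrixDescartes.WallBubbling.SecondOrder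

open Finset Filter Topology
open scoped BigOperators
open Summit.ValiantsHypothesis.ValiantsHypothesis.Theorems.LacunarySymmetroidMatrixDescartes.WallBubbling.Bubbling

/-- Symmetry of a realisable stage vector: `a (x,y) = a (y,x)`. [folklore] -/
theorem stage_symm {a : Fin 6 × Fin 6 → ℝ} (ha : Realisable (Matrix.of fun x y => a (x, y))) (x y : Fin 6) : a (x, y) = a (y, x) := by
  obtain ⟨ε, S, -, -, h⟩ := ha
  have hx := h x y
  have hy := h y x
  simp only [Matrix.of_apply] at hx hy
  rw [hx, hy, polar_comm]

/-- A bound on a member over a finite member set: `|Σ_{p∈V} a_p ε_p^r| / μ ≤ |V|·K·w^r` when each `|a_p| ≤ K μ` and `|ε_p| ≤ w`. [folklore] -/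
theorem moment_finset_bound (V : Finset (Fin 6 × Fin 6)) (a ε : Fin 6 × Fin 6 → ℝ) (μ w K : ℝ) (hμ : 0 < μ)
    (ha : ∀ p ∈ V, |a p| ≤ K * μ) (hε : ∀ p ∈ V, |ε p| ≤ w) (r : ℕ) :
    |(∑ p ∈ V, a p * ε p ^ r) / μ| ≤ V.card * K * w ^ r := by
  rw [abs_div, abs_of_pos hμ, div_le_iff₀ hμ]
  calc |∑ p ∈ V, a p * ε p ^ r| ≤ ∑ p ∈ V, |a p * ε p ^ r| := Finset.abs_sum_le_sum_abs _ _
    _ ≤ ∑ _p ∈ V, K * μ * w ^ r := by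
        refine Finset.sum_le_sum fun p hp => ?_
        rw [abs_mul, abs_pow]
        have hK : 0 ≤ K * μ := (abs_nonneg _).trans (ha p hp)
        exact mul_le_mul (ha p hp) (pow_le_pow_left₀ (abs_nonneg _) (hε p hp) r) (pow_nonneg (abs_nonneg _) _) hK
    _ = V.card * K * w ^ r * μ := by rw [Finset.sum_const, nsmul_eq_mul]; ring

/-- **WIRING, case (a).**  One Weyl pair; relation `e_k + e_l = e_m + e_n` among four distinct NON-Weyl letters.  If the scale `μ_ν > 0` dominates
the singleton diagonal classes, the four non-merged cross classes and the merged class sum of the (realisable) stage vectors `a ν`, and the member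
deviations satisfy `|ε ν p| ≤ w_ν → 0`, then every normalised moment of order `r ≥ 1` of the merged class `{(k,l),(l,k),(m,n),(n,m)}` tends to
`0` — the class keeps only its constant slot. [this work] -/
theorem wallWiring_caseA (a : ℕ → Fin 6 × Fin 6 → ℝ) (ha : ∀ ν, Realisable (Matrix.of fun x y => a ν (x, y)))
    (k l m n : Fin 6) (hkl : k ≠ l) (hkm : k ≠ m) (hkn : k ≠ n) (hlm : l ≠ m) (hln : l ≠ n) (hmn : m ≠ n)
    (μ : ℕ → ℝ) (hμ : ∀ ν, 0 < μ ν)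
    (hdiag : ∀ ν, |a ν (k, k)| ≤ μ ν ∧ |a ν (l, l)| ≤ μ ν ∧ |a ν (m, m)| ≤ μ ν ∧ |a ν (n, n)| ≤ μ ν)
    (hcross : ∀ ν, |a ν (k, m)| ≤ μ ν ∧ |a ν (k, n)| ≤ μ ν ∧ |a ν (l, m)| ≤ μ ν ∧ |a ν (l, n)| ≤ μ ν)
    (hsum : ∀ ν, |a ν (k, l) + a ν (l, k) + a ν (m, n) + a ν (n, m)| ≤ μ ν)
    (ε : ℕ → Fin 6 × Fin 6 → ℝ) (w : ℕ → ℝ) (hε : ∀ ν p, |ε ν p| ≤ w ν) (hwlim : Tendsto w atTop (𝓝 0))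
    (r : ℕ) (hr : 1 ≤ r) :
    Tendsto (fun ν => (∑ p ∈ ({(k, l), (l, k), (m, n), (n, m)} : Finset (Fin 6 × Fin 6)), a ν p * ε ν p ^ r) / μ ν) atTop (𝓝 0) := by
  classical
  -- the relative (D)-sieve on the stage matrices, with `C = 1` (the merged class sum is `2 (a_kl + a_mn)` by symmetry)
  have hsum' : ∀ ν, |(Matrix.of fun x y => a ν (x, y)) k l + (Matrix.of fun x y => a ν (x, y)) m n| ≤ 1 * μ ν := by
    intro ν
    simp only [Matrix.of_apply]
    have h := hsum ν
    rw [stage_symm (ha ν) l k, stage_symm (ha ν) n m] at h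
    have : a ν (k, l) + a ν (k, l) + a ν (m, n) + a ν (m, n) = 2 * (a ν (k, l) + a ν (m, n)) := by ring
    rw [this, abs_mul, abs_two] at h
    have hμ' := hμ ν
    have : |a ν (k, l) + a ν (m, n)| ≤ μ ν / 2 := by linarith
    linarith
  obtain ⟨C', hC'⟩ := relative_dSieve (fun ν => Matrix.of fun x y => a ν (x, y)) ha k l m n hkl hkm hkn hlm hln hmn μ hμ 1
    (fun ν => by simpa only [Matrix.of_apply, one_mul] using hdiag ν)
    (fun ν => by simpa only [Matrix.of_apply, one_mul] using hcross ν) hsum'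
  simp only [Matrix.of_apply] at hC'
  -- the mirror member by symmetry, the other two by the relative sieve with the roles of the two pairs exchanged
  obtain ⟨C'', hC''⟩ := relative_dSieve (fun ν => Matrix.of fun x y => a ν (x, y)) ha m n k l hmn hkm.symm hlm.symm hkn.symm hln.symm hkl
    μ hμ 1
    (fun ν => by
      obtain ⟨h1, h2, h3, h4⟩ := hdiag ν
      simpa only [Matrix.of_apply, one_mul] using And.intro h3 (And.intro h4 (And.intro h1 h2)))
    (fun ν => by
      obtain ⟨h1, h2, h3, h4⟩ := hcross ν
      simp only [Matrix.of_apply, one_mul]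
      rw [stage_symm (ha ν) m k, stage_symm (ha ν) m l, stage_symm (ha ν) n k, stage_symm (ha ν) n l]
      exact ⟨h1, h3, h2, h4⟩)
    (fun ν => by
      have := hsum' ν
      simp only [Matrix.of_apply] at this ⊢
      rwa [add_comm])
  simp only [Matrix.of_apply] at hC''
  -- common member bound
  set K : ℝ := max C' C'' with hK
  have hmem : ∀ ν, ∀ p ∈ ({(k, l), (l, k), (m, n), (n, m)} : Finset (Fin 6 × Fin 6)), |a ν p| ≤ K * μ ν := by
    intro ν p hp
    have hμ' := (hμ ν).le
    simp only [Finset.mem_insert, Finset.mem_singleton] at hp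
    rcases hp with rfl | rfl | rfl | rfl
    · exact (hC' ν).trans (mul_le_mul_of_nonneg_right (le_max_left _ _) hμ')
    · rw [stage_symm (ha ν) l k]; exact (hC' ν).trans (mul_le_mul_of_nonneg_right (le_max_left _ _) hμ')
    · exact (hC'' ν).trans (mul_le_mul_of_nonneg_right (le_max_right _ _) hμ')
    · rw [stage_symm (ha ν) n m]; exact (hC'' ν).trans (mul_le_mul_of_nonneg_right (le_max_right _ _) hμ')
  -- squeeze
  have hbound : ∀ ν, |(∑ p ∈ ({(k, l), (l, k), (m, n), (n, m)} : Finset (Fin 6 × Fin 6)), a ν p * ε ν p ^ r) / μ ν|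
      ≤ (({(k, l), (l, k), (m, n), (n, m)} : Finset (Fin 6 × Fin 6)).card : ℝ) * K * w ν ^ r :=
    fun ν => moment_finset_bound _ (a ν) (ε ν) (μ ν) (w ν) K (hμ ν) (hmem ν) (fun p _ => hε ν p) r
  have hlim : Tendsto (fun ν => (({(k, l), (l, k), (m, n), (n, m)} : Finset (Fin 6 × Fin 6)).card : ℝ) * K * w ν ^ r) atTop (𝓝 0) := by
    have := (hwlim.pow r).const_mul ((({(k, l), (l, k), (m, n), (n, m)} : Finset (Fin 6 × Fin 6)).card : ℝ) * K)
    rw [zero_pow (by omega), mul_zero] at this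
    exact this
  exact squeeze_zero_norm (fun ν => by rw [Real.norm_eq_abs]; exact hbound ν) hlim


/-- **WIRING, case (b).**  One Weyl pair `{i,j}`; relation `e₀ + e_k = e_l + e_m` THROUGH its value (`i, k, l, m` distinct, `i ≠ j`; no
hypothesis relating `j` to `k, l, m` is needed for the inequality as stated).  If the scale `μ_ν > 0`
dominates the triple class sum `a(i,i)+a(i,j)+a(j,i)+a(j,j)`, the doubleton sums `a(i,x)+a(j,x)` (`x = l, m`), the singletons among `k,l,m`, the
merged class's constant moment `a(i,k)+a(j,k)+a(l,m)` and its first moment (ordered-pair halves; the mirror members are equal by symmetry), and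
`|ε| ≤ w → 0`, then the normalised SECOND moment of the merged class `{(i,k),(j,k),(l,m)}` tends to `0` — the class keeps the two slots it has in the
confluent determinant on the wall.  Mechanism: `realisable_classGram` (merge `{i,j}` into the letter `i`) + `relative_dSieve` twice + #14's
`moment_two_div_tendsto_zero_of_weylMerged`. [this work] -/
theorem wallWiring_caseB (a : ℕ → Fin 6 × Fin 6 → ℝ) (ha : ∀ ν, Realisable (Matrix.of fun x y => a ν (x, y)))
    (i j k l m : Fin 6) (hij : i ≠ j) (hik : i ≠ k) (hil : i ≠ l) (him : i ≠ m) (hkl : k ≠ l) (hkm : k ≠ m) (hlm : l ≠ m)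
    (μ : ℕ → ℝ) (hμ : ∀ ν, 0 < μ ν)
    (htriple : ∀ ν, |a ν (i, i) + a ν (i, j) + a ν (j, i) + a ν (j, j)| ≤ μ ν)
    (hdoub : ∀ ν, |a ν (i, l) + a ν (j, l)| ≤ μ ν ∧ |a ν (i, m) + a ν (j, m)| ≤ μ ν)
    (hdiag : ∀ ν, |a ν (k, k)| ≤ μ ν ∧ |a ν (l, l)| ≤ μ ν ∧ |a ν (m, m)| ≤ μ ν)
    (hcross : ∀ ν, |a ν (k, l)| ≤ μ ν ∧ |a ν (k, m)| ≤ μ ν)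
    (hsum0 : ∀ ν, |a ν (i, k) + a ν (j, k) + a ν (l, m)| ≤ μ ν)
    (ε : ℕ → Fin 6 × Fin 6 → ℝ) (w : ℕ → ℝ) (hw0 : ∀ ν, 0 ≤ w ν) (hε : ∀ ν p, |ε ν p| ≤ w ν) (hwlim : Tendsto w atTop (𝓝 0))
    (hM1 : ∀ ν, |a ν (i, k) * ε ν (i, k) + a ν (j, k) * ε ν (j, k) + a ν (l, m) * ε ν (l, m)| ≤ μ ν) :
    Tendsto (fun ν => (a ν (i, k) * ε ν (i, k) ^ 2 + a ν (j, k) * ε ν (j, k) ^ 2 + a ν (l, m) * ε ν (l, m) ^ 2) / μ ν) atTop (𝓝 0) := by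
  classical
  -- the merged Gram: letter classes `cls i = {i,j}`, `cls x = {x}` otherwise
  let cls : Fin 6 → Finset (Fin 6) := fun x => if x = i then {i, j} else {x}
  let G' : ℕ → Matrix (Fin 6) (Fin 6) ℝ := fun ν => Matrix.of fun y z => ∑ p ∈ cls y, ∑ q ∈ cls z, (Matrix.of fun x y => a ν (x, y)) p q
  have hG' : ∀ ν, Realisable (G' ν) := fun ν => realisable_classGram (ha ν) cls
  -- entries of the merged Gram on the block `{i,k,l,m}`
  have cls_i : cls i = {i, j} := by simp [cls]
  have cls_ne : ∀ x, x ≠ i → cls x = {x} := fun x hx => by simp [cls, hx]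
  have e_ii : ∀ ν, G' ν i i = a ν (i, i) + a ν (i, j) + a ν (j, i) + a ν (j, j) := by
    intro ν
    simp only [G', Matrix.of_apply, cls_i]
    rw [Finset.sum_pair hij, Finset.sum_pair hij, Finset.sum_pair hij]
    ring
  have e_ix : ∀ ν x, x ≠ i → G' ν i x = a ν (i, x) + a ν (j, x) := by
    intro ν x hx
    simp only [G', Matrix.of_apply, cls_i, cls_ne x hx, Finset.sum_singleton]
    rw [Finset.sum_pair hij]
  have e_xi : ∀ ν x, x ≠ i → G' ν x i = a ν (x, i) + a ν (x, j) := by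
    intro ν x hx
    simp only [G', Matrix.of_apply, cls_i, cls_ne x hx, Finset.sum_singleton]
    rw [Finset.sum_pair hij]
  have e_xy : ∀ ν x y, x ≠ i → y ≠ i → G' ν x y = a ν (x, y) := by
    intro ν x y hx hy
    simp only [G', Matrix.of_apply, cls_ne x hx, cls_ne y hy, Finset.sum_singleton]
  have hki : k ≠ i := fun h => hik h.symm
  have hli : l ≠ i := fun h => hil h.symm
  have hmi : m ≠ i := fun h => him h.symm
  -- first application of the relative sieve: the merged pair is `{(i,k),(l,m)}` in `G'`
  obtain ⟨C', hC'⟩ := relative_dSieve G' hG' i k l m hik hil him hkl hkm hlm μ hμ 1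
    (fun ν => by
      rw [e_ii, e_xy ν k k hki hki, e_xy ν l l hli hli, e_xy ν m m hmi hmi, one_mul]
      exact ⟨htriple ν, hdiag ν⟩)
    (fun ν => by
      rw [e_ix ν l hli, e_ix ν m hmi, e_xy ν k l hki hli, e_xy ν k m hki hmi, one_mul]
      exact ⟨(hdoub ν).1, (hdoub ν).2, (hcross ν).1, (hcross ν).2⟩)
    (fun ν => by
      rw [e_ix ν k hki, e_xy ν l m hli hmi, one_mul]
      have := hsum0 ν
      rwa [add_assoc] at this ⊢)
  -- second application with the two member groups exchanged: bounds `a(l,m)`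
  obtain ⟨C'', hC''⟩ := relative_dSieve G' hG' l m i k hlm hli (fun h => hkl h.symm) hmi (fun h => hkm h.symm) hik μ hμ 1
    (fun ν => by
      rw [e_ii, e_xy ν k k hki hki, e_xy ν l l hli hli, e_xy ν m m hmi hmi, one_mul]
      exact ⟨(hdiag ν).2.1, (hdiag ν).2.2, htriple ν, (hdiag ν).1⟩)
    (fun ν => by
      rw [e_xi ν l hli, e_xi ν m hmi, e_xy ν l k hli hki, e_xy ν m k hmi hki, one_mul]
      obtain ⟨h1, h2⟩ := hdoub ν
      obtain ⟨h3, h4⟩ := hcross ν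
      rw [stage_symm (ha ν) l i, stage_symm (ha ν) l j, stage_symm (ha ν) m i, stage_symm (ha ν) m j,
        stage_symm (ha ν) l k, stage_symm (ha ν) m k]
      exact ⟨h1, h3, h2, h4⟩)
    (fun ν => by
      rw [e_xy ν l m hli hmi, e_ix ν k hki, one_mul]
      have := hsum0 ν
      have e : a ν (l, m) + (a ν (i, k) + a ν (j, k)) = a ν (i, k) + a ν (j, k) + a ν (l, m) := by ring
      rwa [e])
  -- read off: `|a(i,k) + a(j,k)| ≤ C' μ`, `|a(l,m)| ≤ C'' μ`
  have hpair : ∀ ν, |a ν (i, k) + a ν (j, k)| ≤ C' * μ ν := fun ν => by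
    have := hC' ν; rwa [e_ix ν k hki] at this
  have hlm' : ∀ ν, |a ν (l, m)| ≤ C'' * μ ν := fun ν => by
    have := hC'' ν; rwa [e_xy ν l m hli hmi] at this
  -- #14's second-moment lemma on the three-member family `(i,k), (j,k), (l,m)`
  set K : ℝ := max C' C'' with hK
  let a' : ℕ → Fin 3 → ℝ := fun ν => ![a ν (i, k), a ν (j, k), a ν (l, m)]
  let ε' : ℕ → Fin 3 → ℝ := fun ν => ![ε ν (i, k), ε ν (j, k), ε ν (l, m)]
  have h3 : ∀ (f : Fin 3 → ℝ), ∑ x, f x = f 0 + f 1 + f 2 := fun f => by rw [Fin.sum_univ_three]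
  have hconv := moment_two_div_tendsto_zero_of_weylMerged a' ε' w μ K (0 : Fin 3) 1 (by decide) hμ hw0
    (fun ν x => by fin_cases x <;> simp [ε'] <;> exact hε ν _) hwlim
    (fun ν => by rw [h3]; simpa [a', ε'] using hM1 ν)
    (fun ν => by
      simp only [a', Matrix.cons_val_zero, Matrix.cons_val_one]
      exact (hpair ν).trans (mul_le_mul_of_nonneg_right (le_max_left _ _) (hμ ν).le))
    (fun ν x hx0 hx1 => by
      fin_cases x
      · exact absurd rfl hx0
      · exact absurd rfl hx1
      · simp only [a']
        exact (hlm' ν).trans (mul_le_mul_of_nonneg_right (le_max_right _ _) (hμ ν).le))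
  refine hconv.congr fun ν => ?_
  rw [h3]
  simp [a', ε']

end Summit.ValiantsHypothesis.ValiantsHypothesis.Theorems.LacunarySymmetroidMatrixDescartes.WallBubbling.SecondOrder
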